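import Summits.BirchSwinnertonDyer.BirchSwinnertonDyer.Theorems.KolyvaginRoadThreeSchneiderTamAtThreeHeightLogNumeratorDeepRefinedLaws
import Summits.BirchSwinnertonDyer.BirchSwinnertonDyer.Theorems.KolyvaginRoadThreeSchneiderTamAtThreeHeightLogNumeratorDeepCriterion
import HarnessLib

/-!
# Crux `SchneiderTamAtThree` (item 19154) — THE HEIGHT IS THE LOGARITHM OF THE NUMERATOR, DEEP POINTS,
# part 7b: the TATE-PARAMETER numerator criterion (precision `2k + min(2k, 2ν)`) and its checker (`3^d ∣ Δ²`)

HONEST FRAMING (cell `bsd-stepL`, seat `bsd-stepL-tam3-p2` g2, WIDTH-LEVER second lane «closed-form Schneider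
local factor at 3 … finite case table proved once»; `--supports stmt-BirchSwinnertonDyer-19154 --as helper`):
THEOREMS ONLY, route-free (no Theses import); 0 definitions, 0 named facts, 0 sorry; every rung is about ONE
curve and is modulo GZK (rank one, by name); Schneider's conjecture is asserted nowhere; nothing class-wide
is proved; BSD is not claimed.

* `heightFourOneCoord_ne_zero_of_num_criterion_deep_j` / `…_of_not_pow_dvd_deep_j` — from part 6b's rational
  closed form for THE Tate parameter (`tateJ q = j`): for a point of level `≥ 2`,
  **`3^{v₃(den x) + d} ∤ N_B`, `N_B = c₄³·[c₄(a³ − a) + 2(b₂b₄ − 18b₆)·den x] + 120·c₆·Δ·den x`**, any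
  `d ≤ v₃(den x)` with `‖1/j‖² ≤ 3^{−d}` (`3^d ∣ Δ²`, i.e. `d ≤ 2v₃Δ`) ⟹ `ĥ₃(P) ≠ 0`.
* `regulatorNonvanishingAt_three_of_num_criterion_deep_j`, `rung(_Tam)_of_numCriterion_deep_j` — rank one and
  the generic checker in lane A's REG3CERT row format (side condition `3^d ∣ Δ²`; `c₆`, `Δ` by the integer
  formulas). The sharpest of the one-congruence certificates of this chain (`d ≤ min(2k, 2ν)` against `ν+1`,
  `ν`, `1`); on lane A's table it decides nothing the `ν+1` checker does not (kit j285773), recorded for the method.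

References: [SteinWuthrich2013] §4.2, Conj. 4.1; [Schneider1982PadicHeightI] §1; [KolyvaginEulerSystems1990]
Thm. A; [SilvermanAEC2009] III.1, VII.2; tree: deep parts 4, 6b, lane A `ClassRecordThreeRegCertKernel{,O2Cert}`.
-/

noncomputable section

open scoped Classical Nat
open Filter Topology IsUltrametricDist PowerSeries
open WeierstrassCurve Literature.NumberTheory.EllipticCurves
open Literature.NumberTheory.EllipticCurves.SteinWuthrich2013
open Literature.NumberTheory.EllipticCurves.TateCurve
open Literature.NumberTheory.EllipticCurves.Rank1Residual
open Summit.BirchSwinnertonDyer.Uniform.UI.O2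
open Summit.BirchSwinnertonDyer.Rank1Residual Summit.BirchSwinnertonDyer.Rank1Residual.X11b

namespace Summit.BirchSwinnertonDyer.Rank1Residual.X11b.RegMult.HeightLogNumerator

/-! ### §17 The Tate-parameter criterion -/

section Criterion

variable {W : WeierstrassCurve ℚ}

/-- **THE TATE-PARAMETER NUMERATOR CRITERION** (from part 6b's `…_deep_j`): for `tateJ q = j(W)` and a
rational point of level `≥ 2`, `‖c₄a(a² − 1) + 2(b₂b₄ − 18b₆)D + 120c₆·j⁻¹·D‖₃ > ‖x‖₃⁻¹·max(‖x‖₃⁻¹, ‖q‖₃²)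
⟹ ĥ₃(P) ≠ 0`. [cite: SteinWuthrich2013, §4.2, Conj. 4.1] [cite: Schneider1982PadicHeightI, §1] -/
theorem heightFourOneCoord_ne_zero_of_num_criterion_deep_j [W.IsElliptic] [W.IsGloballyMinimal]
    (hW : Mult W 3) {q : ℚ_[3]} (hq : ‖q‖ < 1) (hj : tateJ q = (W.j : ℚ_[3])) {x y : ℚ}
    (hxy : W.toAffine.Nonsingular x y) (hx : 1 < ‖(x : ℚ_[3])‖) (hz9 : ‖-(x : ℚ_[3]) / y‖ ≤ 1 / 9)
    (hcrit : ‖(x : ℚ_[3])‖⁻¹ * max ‖(x : ℚ_[3])‖⁻¹ (‖q‖ ^ 2) <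
      ‖(W.baseChange ℚ_[3]).c₄ * ((x.num : ℚ) : ℚ_[3]) * (((x.num : ℚ) : ℚ_[3]) ^ 2 - 1) +
          2 * ((W.baseChange ℚ_[3]).b₂ * (W.baseChange ℚ_[3]).b₄ - 18 * (W.baseChange ℚ_[3]).b₆) *
            ((x.den : ℚ) : ℚ_[3]) +
          120 * (W.baseChange ℚ_[3]).c₆ * ((W.j : ℚ_[3]))⁻¹ * ((x.den : ℚ) : ℚ_[3])‖) :
    heightFourOneCoord W 3 q x y ≠ 0 := by
  set X : ℚ_[3] := (x : ℚ_[3]) with hXdef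
  set V := W.baseChange ℚ_[3] with hVdef
  set a : ℚ_[3] := ((x.num : ℚ) : ℚ_[3]) with hadef
  set D : ℚ_[3] := ((x.den : ℚ) : ℚ_[3]) with hDdef
  set ε : ℝ := ‖X‖⁻¹ * max ‖X‖⁻¹ (‖q‖ ^ 2) with hεdef
  set J : ℚ_[3] := ((W.j : ℚ_[3]))⁻¹ with hJdef
  set κ' : ℚ_[3] := (V.b₂ * V.b₄ - 18 * V.b₆) / V.c₄ + 60 * (V.c₆ / V.c₄) * J with hκ'def
  have hX0n : 0 < ‖X‖ := one_pos.trans hx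
  have hXi1 : ‖X‖⁻¹ ≤ 1 := inv_le_one_of_one_le₀ hx.le
  have hnum : a = X * D := by rw [hadef, hXdef, hDdef, ← Rat.cast_mul, Rat.mul_den_eq_num]
  have hDn : ‖D‖ = ‖X‖⁻¹ := by rw [hDdef]; exact norm_den_eq_inv_norm hx
  have han : ‖a‖ = 1 := by rw [hnum, norm_mul, hDn, mul_inv_cancel₀ hX0n.ne']
  have ha0 : a ≠ 0 := norm_pos_iff.mp (by rw [han]; exact one_pos)
  have hd0 : D ≠ 0 := by rw [hDdef]; exact_mod_cast x.den_nz
  obtain ⟨hc4, hc6⟩ := norm_c₄_c₆_baseChange_eq_one (W := W) hW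
  have hc40 : V.c₄ ≠ 0 := norm_pos_iff.mp (by rw [hc4]; exact one_pos)
  have hqJ : ‖q‖ = ‖J‖ := by rw [hJdef, norm_inv, ← hj, norm_tateJ_eq hq, inv_inv]
  have h2n : ‖(2 : ℚ_[3])‖ = 1 := by
    simpa using Padic.norm_natCast_eq_one_iff.mpr (show Nat.Coprime 3 2 by decide)
  have hmax1 : max ‖X‖⁻¹ (‖q‖ ^ 2) ≤ 1 := max_le hXi1 (pow_le_one₀ (norm_nonneg _) hq.le)
  have hεX : ε ≤ ‖X‖⁻¹ := by
    calc ε = ‖X‖⁻¹ * max ‖X‖⁻¹ (‖q‖ ^ 2) := rfl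
      _ ≤ ‖X‖⁻¹ * 1 := by gcongr
      _ = ‖X‖⁻¹ := mul_one _
  have hXXε : ‖X‖⁻¹ * ‖X‖⁻¹ ≤ ε := by
    calc ‖X‖⁻¹ * ‖X‖⁻¹ ≤ ‖X‖⁻¹ * max ‖X‖⁻¹ (‖q‖ ^ 2) := by gcongr; exact le_max_left _ _
      _ = ε := rfl
  -- `κ'` is a `3`-adic integer
  have hκ' : ‖κ'‖ ≤ 1 := by
    obtain ⟨hb2, hb4, hb6⟩ : ‖V.b₂‖ ≤ 1 ∧ ‖V.b₄‖ ≤ 1 ∧ ‖V.b₆‖ ≤ 1 := by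
      have h := V.eq_map_integralModel
      refine ⟨?_, ?_, ?_⟩
      · have e := congrArg WeierstrassCurve.b₂ h
        rw [map_b₂] at e; rw [← e]; exact PadicInt.norm_le_one _
      · have e := congrArg WeierstrassCurve.b₄ h
        rw [map_b₄] at e; rw [← e]; exact PadicInt.norm_le_one _
      · have e := congrArg WeierstrassCurve.b₆ h
        rw [map_b₆] at e; rw [← e]; exact PadicInt.norm_le_one _
    rw [hκ'def]
    refine (norm_add_le_max _ _).trans (max_le ?_ ?_)
    · rw [norm_div, hc4, div_one]
      refine (norm_sub_le_max₃ _ _).trans (max_le ?_ ?_)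
      · rw [norm_mul]
        calc ‖V.b₂‖ * ‖V.b₄‖ ≤ 1 * 1 := by gcongr
          _ = 1 := one_mul _
      · rw [norm_mul]
        have h18 : ‖(18 : ℚ_[3])‖ ≤ 1 := by
          have h : ((18 : ℤ) : ℚ_[3]) = 18 := by norm_cast
          rw [← h]; exact Padic.norm_int_le_one 18
        calc ‖(18 : ℚ_[3])‖ * ‖V.b₆‖ ≤ 1 * 1 := by gcongr
          _ = 1 := one_mul _
    · rw [norm_mul, norm_mul, norm_div, hc6, hc4, div_one, mul_one, ← hqJ]
      have h60 : ‖(60 : ℚ_[3])‖ ≤ 1 := by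
        have h : ((60 : ℤ) : ℚ_[3]) = 60 := by norm_cast
        rw [← h]; exact Padic.norm_int_le_one 60
      calc ‖(60 : ℚ_[3])‖ * ‖q‖ ≤ 1 * 1 := mul_le_mul h60 hq.le (norm_nonneg _) zero_le_one
        _ = 1 := one_mul _
  -- the deep-point law
  have hR := norm_heightFourOneCoord_sub_padicLog_num_sub_le_deep_j hW hq hj hxy hx hz9
  intro hH
  rw [hH, zero_sub] at hR
  have hloga : ‖padicLog 3 a‖ = ‖a ^ 2 - 1‖ := by
    rw [SchneiderClosedFormOddPrime.norm_padicLog_of_norm_eq_one (p := 3) (by norm_num) han,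
      show (3 - 1 : ℕ) = 2 from rfl, norm_sub_rev]
  rcases lt_or_ge ‖X‖⁻¹ ‖a ^ 2 - 1‖ with h1 | h1
  · -- first order decides: `‖log a‖ ≤ ‖X‖⁻¹ < ‖a² − 1‖ = ‖log a‖`
    have hκD : ‖κ' * (D / a)‖ ≤ ‖X‖⁻¹ := by
      rw [norm_mul, norm_div D a, han, div_one, hDn]
      calc ‖κ'‖ * ‖X‖⁻¹ ≤ 1 * ‖X‖⁻¹ := by gcongr
        _ = ‖X‖⁻¹ := one_mul _
    have hlog : ‖padicLog 3 a‖ ≤ ‖X‖⁻¹ := by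
      have e : padicLog 3 a = -(-padicLog 3 a - κ' * (D / a)) - κ' * (D / a) := by ring
      rw [e]
      refine (norm_sub_le_max₃ _ _).trans (max_le ?_ hκD)
      rw [norm_neg]
      exact hR.trans hεX
    rw [hloga] at hlog
    exact absurd h1 (not_lt.mpr hlog)
  · -- first order silent: `‖2ac₄·0 − N‖ ≤ max(ε, ‖a² − 1‖²) = ε < ‖N‖`
    set G : ℚ_[3] := padicLog 3 a - (a ^ 2 - 1) / 2 with hGdef
    have hG : ‖G‖ ≤ ‖a ^ 2 - 1‖ ^ 2 := by
      have h := norm_padicLog_sub_div_le (p := 3) (by norm_num) han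
      rw [show (3 - 1 : ℕ) = 2 from rfl, show ((3 : ℕ) : ℚ_[3]) - 1 = 2 by norm_num] at h
      exact h
    have e : V.c₄ * a * (a ^ 2 - 1) + 2 * (V.b₂ * V.b₄ - 18 * V.b₆) * D + 120 * V.c₆ * J * D =
        -(2 * a * V.c₄ * ((-padicLog 3 a - κ' * (D / a)) + G)) := by
      rw [hGdef, hκ'def]
      field_simp
      ring
    have hle : ‖V.c₄ * a * (a ^ 2 - 1) + 2 * (V.b₂ * V.b₄ - 18 * V.b₆) * D + 120 * V.c₆ * J * D‖ ≤ ε := by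
      rw [e, norm_neg, norm_mul, norm_mul, norm_mul, h2n, han, hc4, one_mul, one_mul, one_mul]
      refine (norm_add_le_max _ _).trans (max_le hR (hG.trans ?_))
      calc ‖a ^ 2 - 1‖ ^ 2 ≤ ‖X‖⁻¹ ^ 2 := by gcongr
        _ = ‖X‖⁻¹ * ‖X‖⁻¹ := sq _
        _ ≤ ε := hXXε
    exact absurd hcrit (not_lt.mpr hle)

/-- **The Tate-parameter criterion in integers.** With `N = c₄³·[c₄(a³ − a) + 2(b₂b₄ − 18b₆)·den x] +
120·c₆·Δ·den x` (`a = num x`; `b₂, b₄, b₆, c₄, c₆, Δ` of the minimal model; `1/j = Δ/c₄³`, `‖c₄‖₃ = 1`), level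
`≥ 2`, `d ≤ v₃(den x)`, `‖q‖² ≤ 3^{−d}` and **`3^{v₃(den x) + d} ∤ N`**: `ĥ₃(P) ≠ 0` (`d = min(2k, 2v₃Δ)` for the
Tate parameter). [cite: SteinWuthrich2013, §4.2, Conj. 4.1] -/
theorem heightFourOneCoord_ne_zero_of_not_pow_dvd_deep_j [W.IsElliptic] [W.IsGloballyMinimal]
    (hW : Mult W 3) {q : ℚ_[3]} (hq : ‖q‖ < 1) (hj : tateJ q = (W.j : ℚ_[3])) {x y : ℚ}
    (hxy : W.toAffine.Nonsingular x y) (hx : 1 < ‖(x : ℚ_[3])‖) (h4 : 4 ≤ padicValNat 3 x.den) {d : ℕ}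
    (hd : d ≤ padicValNat 3 x.den) (hqd : ‖q‖ ^ 2 ≤ (3 : ℝ) ^ (-(d : ℤ))) {N : ℤ}
    (hN : W.c₄ ^ 3 * (W.c₄ * ((x.num : ℚ) ^ 3 - x.num) + 2 * (W.b₂ * W.b₄ - 18 * W.b₆) * (x.den : ℚ)) +
      120 * W.c₆ * W.Δ * (x.den : ℚ) = (N : ℚ))
    (h : ¬ ((3 : ℤ) ^ (padicValNat 3 x.den + d) ∣ N)) :
    heightFourOneCoord W 3 q x y ≠ 0 := by
  have hden : ‖(x : ℚ_[3])‖⁻¹ = (3 : ℝ) ^ (-(padicValNat 3 x.den : ℤ)) := by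
    rw [← norm_den_eq_inv_norm hx, Rat.cast_natCast,
      Padic.norm_eq_zpow_neg_valuation (by exact_mod_cast x.den_nz), Padic.valuation_natCast]
    norm_cast
  -- level `≥ 2`: `‖z‖² = ‖x‖⁻¹ ≤ 3⁻⁴`
  have hz9 : ‖-(x : ℚ_[3]) / y‖ ≤ 1 / 9 := by
    obtain ⟨-, hz2⟩ := norm_neg_div_of_one_lt_norm (p := 3) hxy hx
    have hsq : ‖-(x : ℚ_[3]) / y‖ ^ 2 ≤ (1 / 9) ^ 2 := by
      rw [hz2, hden]
      calc (3 : ℝ) ^ (-(padicValNat 3 x.den : ℤ)) ≤ (3 : ℝ) ^ (-(4 : ℤ)) := by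
            apply zpow_le_zpow_right₀ (by norm_num); omega
        _ = (1 / 9) ^ 2 := by norm_num
    exact (pow_le_pow_iff_left₀ (norm_nonneg _) (by norm_num) two_ne_zero).mp hsq
  refine heightFourOneCoord_ne_zero_of_num_criterion_deep_j hW hq hj hxy hx hz9 ?_
  have hc4 : (W.baseChange ℚ_[3]).c₄ = ((W.c₄ : ℚ) : ℚ_[3]) :=
    (map_c₄ W (algebraMap ℚ ℚ_[3])).trans (eq_ratCast _ _)
  have hb2 : (W.baseChange ℚ_[3]).b₂ = ((W.b₂ : ℚ) : ℚ_[3]) :=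
    (map_b₂ W (algebraMap ℚ ℚ_[3])).trans (eq_ratCast _ _)
  have hb4 : (W.baseChange ℚ_[3]).b₄ = ((W.b₄ : ℚ) : ℚ_[3]) :=
    (map_b₄ W (algebraMap ℚ ℚ_[3])).trans (eq_ratCast _ _)
  have hb6 : (W.baseChange ℚ_[3]).b₆ = ((W.b₆ : ℚ) : ℚ_[3]) :=
    (map_b₆ W (algebraMap ℚ ℚ_[3])).trans (eq_ratCast _ _)
  have hc6 : (W.baseChange ℚ_[3]).c₆ = ((W.c₆ : ℚ) : ℚ_[3]) :=
    (map_c₆ W (algebraMap ℚ ℚ_[3])).trans (eq_ratCast _ _)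
  obtain ⟨hc4n, -⟩ := norm_c₄_c₆_baseChange_eq_one (W := W) hW
  rw [hc4] at hc4n
  have hc4q0 : ((W.c₄ : ℚ) : ℚ_[3]) ≠ 0 := norm_pos_iff.mp (by rw [hc4n]; exact one_pos)
  have hΔ0 : ((W.Δ : ℚ) : ℚ_[3]) ≠ 0 := by exact_mod_cast W.Δ'.ne_zero
  -- `1/j = Δ/c₄³`
  have hjinv : ((W.j : ℚ_[3]))⁻¹ = ((W.Δ : ℚ) : ℚ_[3]) / ((W.c₄ : ℚ) : ℚ_[3]) ^ 3 := by
    have hjq : W.j = W.c₄ ^ 3 / W.Δ := by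
      rw [WeierstrassCurve.j, Units.val_inv_eq_inv_val, WeierstrassCurve.coe_Δ', div_eq_mul_inv, mul_comm]
    rw [hjq]; push_cast; rw [inv_div]
  have hcast : (W.baseChange ℚ_[3]).c₄ * ((x.num : ℚ) : ℚ_[3]) * (((x.num : ℚ) : ℚ_[3]) ^ 2 - 1) +
      2 * ((W.baseChange ℚ_[3]).b₂ * (W.baseChange ℚ_[3]).b₄ - 18 * (W.baseChange ℚ_[3]).b₆) *
        ((x.den : ℚ) : ℚ_[3]) + 120 * (W.baseChange ℚ_[3]).c₆ * ((W.j : ℚ_[3]))⁻¹ * ((x.den : ℚ) : ℚ_[3]) =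
      ((N : ℚ) : ℚ_[3]) / ((W.c₄ : ℚ) : ℚ_[3]) ^ 3 := by
    rw [hc4, hb2, hb4, hb6, hc6, hjinv, ← hN, eq_div_iff (pow_ne_zero 3 hc4q0)]
    push_cast
    field_simp
  rw [hcast, norm_div, norm_pow, hc4n, one_pow, div_one, hden, Rat.cast_intCast]
  -- `ε ≤ 3^{−(v + d)} < ‖N‖`
  have hε : (3 : ℝ) ^ (-(padicValNat 3 x.den : ℤ)) * max ((3 : ℝ) ^ (-(padicValNat 3 x.den : ℤ))) (‖q‖ ^ 2) ≤
      (3 : ℝ) ^ (-((padicValNat 3 x.den + d : ℕ) : ℤ)) := by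
    have hm : max ((3 : ℝ) ^ (-(padicValNat 3 x.den : ℤ))) (‖q‖ ^ 2) ≤ (3 : ℝ) ^ (-(d : ℤ)) :=
      max_le (zpow_le_zpow_right₀ (by norm_num) (by omega)) hqd
    calc (3 : ℝ) ^ (-(padicValNat 3 x.den : ℤ)) * max ((3 : ℝ) ^ (-(padicValNat 3 x.den : ℤ))) (‖q‖ ^ 2)
        ≤ (3 : ℝ) ^ (-(padicValNat 3 x.den : ℤ)) * (3 : ℝ) ^ (-(d : ℤ)) := by gcongr
      _ = (3 : ℝ) ^ (-((padicValNat 3 x.den + d : ℕ) : ℤ)) := by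
        rw [← zpow_add₀ (by norm_num : (3 : ℝ) ≠ 0)]; congr 1; push_cast; ring
  refine lt_of_le_of_lt hε ?_
  by_contra hle
  exact h ((Padic.norm_int_le_pow_iff_dvd _ _).mp (by exact_mod_cast not_lt.mp hle))

end Criterion

/-! ### §18 Rank one and the generic checker -/

section RankOne

variable {W : WeierstrassCurve ℚ}

/-- **Schneider's binder at `3` from ONE rational point of level `≥ 2`, by integer arithmetic (Tate-parameter
precision).** For `W/ℚ` globally minimal, NON-split multiplicative at `3`, of Mordell–Weil rank one, with
`‖1/j‖₃² ≤ 3^{−d}` (`3^d ∣ Δ²`, `3 ∤ c₄`): an ADMISSIBLE rational point with `3⁴ ∣ den x`, `d ≤ v₃(den x)` and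
`3^{v₃(den x)+d} ∤ c₄³[c₄((num x)³ − num x) + 2(b₂b₄ − 18b₆)·den x] + 120c₆Δ·den x` gives
`ClassClosure.RegulatorNonvanishingAt W 3` (for THE Tate parameter `‖q‖₃ = ‖j‖₃⁻¹`, `norm_tateJ_eq`).
[cite: SteinWuthrich2013, §4.2, Conj. 4.1] [cite: Schneider1982PadicHeightI, §1] -/
theorem regulatorNonvanishingAt_three_of_num_criterion_deep_j [W.IsElliptic] [W.IsGloballyMinimal]
    (hW : Mult W 3) (hns : ¬ W.HasSplitMultiplicativeReductionAtPrime 3) (hr : W.mordellWeilRank = 1)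
    {x y : ℚ} {h : W.toAffine.Nonsingular x y} (hadm : W.IsAdmissible 3 (.some x y h))
    (h4 : 4 ≤ padicValNat 3 x.den) {d : ℕ} (hd : d ≤ padicValNat 3 x.den)
    (hjd : ‖((W.j : ℚ_[3]))⁻¹‖ ^ 2 ≤ (3 : ℝ) ^ (-(d : ℤ))) {N : ℤ}
    (hN : W.c₄ ^ 3 * (W.c₄ * ((x.num : ℚ) ^ 3 - x.num) + 2 * (W.b₂ * W.b₄ - 18 * W.b₆) * (x.den : ℚ)) +
      120 * W.c₆ * W.Δ * (x.den : ℚ) = (N : ℚ))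
    (hcrit : ¬ ((3 : ℤ) ^ (padicValNat 3 x.den + d) ∣ N)) :
    X11b.ClassClosure.RegulatorNonvanishingAt W 3 := by
  refine ⟨fun q Dh _ hq1 hj hDh => ?_, fun Dq _ _ => absurd Dq.split hns⟩
  refine X11b.schneider_of_isMultCanonical_of_heightFourOne_ne_zero hr hDh hadm ?_
  rw [heightFourOne_some]
  have hqd : ‖q‖ ^ 2 ≤ (3 : ℝ) ^ (-(d : ℤ)) := by
    have e : ‖q‖ = ‖((W.j : ℚ_[3]))⁻¹‖ := by rw [norm_inv, ← hj, norm_tateJ_eq hq1, inv_inv]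
    rw [e]; exact hjd
  exact heightFourOneCoord_ne_zero_of_not_pow_dvd_deep_j hW hq1 hj h hadm.2.1 h4 hd hqd hN hcrit

/-- **Generic TATE-PARAMETER REG3CERT checker, class-record shape** (crux `SchneiderAtThree`, item 19106): for
the integer model `W = ⟨a₁,…,a₆⟩`, the point `Q = (a/e², b/e³)` with `e = 3ᵏe'`, `2 ≤ k`, `3 ∤ e'`, `gcd(a, e) = 1`,
the gcd test, `c₄`, `c₆`, `Δ` by the integer formulas, `3 ∤ c₄`, `3^d ∣ Δ²`, `d ≤ 2k`, and **`3^{2k+d} ∤ N`,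
`N = c₄³[c₄(a³ − a) + 2(b₂b₄ − 18b₆)e²] + 120c₆Δe²`**, the rung `ClassX11b W 3 → Ram W 3 → ¬split(3) →
RegulatorNonvanishingAt W 3` holds modulo GZK. ONE curve per application; `norm_num`/`decide` hypotheses only.
[cite: SteinWuthrich2013, §4.2 and Conj. 4.1] [cite: SilvermanAEC2009, III.1, VII.2.1] [cite: KolyvaginEulerSystems1990, Thm. A] -/
theorem rung_of_numCriterion_deep_j (hGZK : rank_eq_analyticRank_of_analyticRank_le_one)
    (W : WeierstrassCurve ℚ) {a₁ a₂ a₃ a₄ a₆ : ℤ} (hW : W = ⟨a₁, a₂, a₃, a₄, a₆⟩) [W.IsElliptic]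
    [W.IsGloballyMinimal] {a b N c4 c6 Dsc : ℤ} {e' k n d : ℕ}
    (H : ¬ 3 ∣ e' ∧ 2 ≤ k ∧ Nat.Coprime a.natAbs (3 ^ k * e') ∧
      Int.gcd (2 * b + a₁ * a * (3 ^ k * e' : ℕ) + a₃ * (3 ^ k * e' : ℕ) ^ 3)
        (a₁ * b * (3 ^ k * e' : ℕ) - (3 * a ^ 2 + 2 * a₂ * a * (3 ^ k * e' : ℕ) ^ 2 + a₄ * (3 ^ k * e' : ℕ) ^ 4))
        ∣ (3 ^ k * e') ^ n ∧
      c4 = (a₁ ^ 2 + 4 * a₂) ^ 2 - 24 * (2 * a₄ + a₁ * a₃) ∧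
      c6 = -(a₁ ^ 2 + 4 * a₂) ^ 3 + 36 * (a₁ ^ 2 + 4 * a₂) * (2 * a₄ + a₁ * a₃) - 216 * (a₃ ^ 2 + 4 * a₆) ∧
      Dsc = -(a₁ ^ 2 + 4 * a₂) ^ 2 * (a₁ ^ 2 * a₆ + 4 * a₂ * a₆ - a₁ * a₃ * a₄ + a₂ * a₃ ^ 2 - a₄ ^ 2) -
        8 * (2 * a₄ + a₁ * a₃) ^ 3 - 27 * (a₃ ^ 2 + 4 * a₆) ^ 2 +
        9 * (a₁ ^ 2 + 4 * a₂) * (2 * a₄ + a₁ * a₃) * (a₃ ^ 2 + 4 * a₆) ∧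
      ¬ (3 : ℤ) ∣ c4 ∧ (3 : ℤ) ^ d ∣ Dsc ^ 2 ∧ d ≤ 2 * k ∧
      c4 ^ 3 * (c4 * (a ^ 3 - a) + 2 * ((a₁ ^ 2 + 4 * a₂) * (2 * a₄ + a₁ * a₃) - 18 * (a₃ ^ 2 + 4 * a₆)) *
        ((3 ^ k * e' : ℕ) : ℤ) ^ 2) + 120 * c6 * Dsc * ((3 ^ k * e' : ℕ) : ℤ) ^ 2 = N ∧
      ¬ (3 : ℤ) ^ (2 * k + d) ∣ N)
    {x y : ℚ} (hx : x = a / ((3 ^ k * e' : ℕ) : ℚ) ^ 2) (hy : y = b / ((3 ^ k * e' : ℕ) : ℚ) ^ 3)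
    (hP : W.toAffine.Equation x y) :
    ClassX11b W 3 → Ram W 3 → ¬ W.HasSplitMultiplicativeReductionAtPrime 3 →
      ClassClosure.RegulatorNonvanishingAt W 3 := by
  intro hX _ hns
  obtain ⟨h3e', hk, hcop, hgcd, hc4, hc6, hD, h3c4, h3D, hdk, hN, hcrit⟩ := H
  haveI : Fact (Nat.Prime 3) := ⟨Nat.prime_three⟩
  have he'0 : e' ≠ 0 := by rintro rfl; exact h3e' (dvd_zero 3)
  have he0 : (3 ^ k * e' : ℕ) ≠ 0 := by positivity
  have h3e : 3 ∣ 3 ^ k * e' := dvd_mul_of_dvd_left (dvd_pow_self 3 (by omega)) _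
  have h : W.toAffine.Nonsingular x y :=
    (WeierstrassCurve.Affine.equation_iff_nonsingular (W := W.toAffine)).mp hP
  have hx1 : 1 < ‖(x : ℚ_[3])‖ :=
    (one_lt_norm_ratCast_iff 3 x).mpr (KernelCert.padicValRat_x_neg he0 hx hcop h3e)
  have hadm : W.IsAdmissible 3 (.some x y h) :=
    isAdmissible_of_one_lt_norm (by norm_num) h hx1
      (KernelCert.hasNonsingularReductionAt_of_gcd W hW he0 hx hy hcop hgcd)
  -- `num x = a`, `den x = e²`, `v₃(den x) = 2k`
  set e : ℕ := 3 ^ k * e' with hedef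
  have hcop2 : Nat.Coprime a.natAbs (((e : ℤ) ^ 2).natAbs) := by
    rw [Int.natAbs_pow, Int.natAbs_natCast]; exact hcop.pow_right 2
  have he2pos : (0 : ℤ) < (e : ℤ) ^ 2 := by positivity
  have hxq : x = ((a : ℤ) : ℚ) / (((e : ℤ) ^ 2 : ℤ) : ℚ) := by rw [hx]; push_cast; ring
  have hnum : x.num = a := by rw [hxq]; exact Rat.num_div_eq_of_coprime he2pos hcop2
  have hden : (x.den : ℤ) = (e : ℤ) ^ 2 := by rw [hxq]; exact Rat.den_div_eq_of_coprime he2pos hcop2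
  have hden' : x.den = e ^ 2 := by exact_mod_cast hden
  have hv : padicValNat 3 x.den = 2 * k := by
    rw [hden', hedef, padicValNat.pow (3 ^ k * e') 2, padicValNat.mul (pow_ne_zero _ (by norm_num)) he'0,
      padicValNat.prime_pow, padicValNat.eq_zero_of_not_dvd h3e']
    ring
  -- the integer identity
  have hN' : W.c₄ ^ 3 * (W.c₄ * ((x.num : ℚ) ^ 3 - x.num) + 2 * (W.b₂ * W.b₄ - 18 * W.b₆) * (x.den : ℚ)) +
      120 * W.c₆ * W.Δ * (x.den : ℚ) = (N : ℚ) := by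
    rw [hnum, show (x.den : ℚ) = ((x.den : ℤ) : ℚ) by norm_cast, hden, ← hN, hc4, hc6, hD]
    subst hW
    simp only [WeierstrassCurve.c₄, WeierstrassCurve.c₆, WeierstrassCurve.Δ, WeierstrassCurve.b₂,
      WeierstrassCurve.b₄, WeierstrassCurve.b₆, WeierstrassCurve.b₈]
    push_cast
    ring
  -- `‖1/j‖₃² = ‖Δ/c₄³‖₃² = ‖Δ²‖₃ ≤ 3^{−d}`
  have hjd : ‖((W.j : ℚ_[3]))⁻¹‖ ^ 2 ≤ (3 : ℝ) ^ (-(d : ℤ)) := by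
    rw [KernelCert.ratCast_j_inv_eq W hW hc4 hD, norm_div, norm_pow]
    have hc4n : ‖(c4 : ℚ_[3])‖ = 1 := by
      have hle := Padic.norm_int_le_one (p := 3) c4
      have hnlt : ¬ ‖(c4 : ℚ_[3])‖ < 1 := fun hlt =>
        h3c4 (by exact_mod_cast (Padic.norm_intCast_lt_one_iff (p := 3)).mp hlt)
      exact le_antisymm hle (not_lt.mp hnlt)
    rw [hc4n, one_pow, div_one, ← norm_pow]
    have h3D' : ((3 : ℕ) : ℤ) ^ d ∣ Dsc ^ 2 := by exact_mod_cast h3D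
    have h := (Padic.norm_int_le_pow_iff_dvd (p := 3) (Dsc ^ 2) d).mpr h3D'
    simp only [Int.cast_pow, Nat.cast_ofNat] at h
    exact h
  have h4 : 4 ≤ padicValNat 3 x.den := by rw [hv]; omega
  have hd' : d ≤ padicValNat 3 x.den := by rw [hv]; exact hdk
  have hcrit' : ¬ ((3 : ℤ) ^ (padicValNat 3 x.den + d) ∣ N) := by rwa [hv]
  exact regulatorNonvanishingAt_three_of_num_criterion_deep_j hX.2.2.1 hns
    (mordellWeilRank_eq_one_of_analyticRank hGZK hX.1) hadm h4 hd' hjd hN' hcrit'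

/-- **Generic TATE-PARAMETER REG3CERT checker, Kolyvagin-road shape** (crux `SchneiderTamAtThree`, item 19154): the
same rung with the extra binder `3 ∣ ∏ c_ℓ`, not used. ONE curve per application.
[cite: SteinWuthrich2013, §4.2 and Conj. 4.1] [cite: KolyvaginEulerSystems1990, Thm. A] -/
theorem rungTam_of_numCriterion_deep_j (hGZK : rank_eq_analyticRank_of_analyticRank_le_one)
    (W : WeierstrassCurve ℚ) {a₁ a₂ a₃ a₄ a₆ : ℤ} (hW : W = ⟨a₁, a₂, a₃, a₄, a₆⟩) [W.IsElliptic]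
    [W.IsGloballyMinimal] {a b N c4 c6 Dsc : ℤ} {e' k n d : ℕ}
    (H : ¬ 3 ∣ e' ∧ 2 ≤ k ∧ Nat.Coprime a.natAbs (3 ^ k * e') ∧
      Int.gcd (2 * b + a₁ * a * (3 ^ k * e' : ℕ) + a₃ * (3 ^ k * e' : ℕ) ^ 3)
        (a₁ * b * (3 ^ k * e' : ℕ) - (3 * a ^ 2 + 2 * a₂ * a * (3 ^ k * e' : ℕ) ^ 2 + a₄ * (3 ^ k * e' : ℕ) ^ 4))
        ∣ (3 ^ k * e') ^ n ∧
      c4 = (a₁ ^ 2 + 4 * a₂) ^ 2 - 24 * (2 * a₄ + a₁ * a₃) ∧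
      c6 = -(a₁ ^ 2 + 4 * a₂) ^ 3 + 36 * (a₁ ^ 2 + 4 * a₂) * (2 * a₄ + a₁ * a₃) - 216 * (a₃ ^ 2 + 4 * a₆) ∧
      Dsc = -(a₁ ^ 2 + 4 * a₂) ^ 2 * (a₁ ^ 2 * a₆ + 4 * a₂ * a₆ - a₁ * a₃ * a₄ + a₂ * a₃ ^ 2 - a₄ ^ 2) -
        8 * (2 * a₄ + a₁ * a₃) ^ 3 - 27 * (a₃ ^ 2 + 4 * a₆) ^ 2 +
        9 * (a₁ ^ 2 + 4 * a₂) * (2 * a₄ + a₁ * a₃) * (a₃ ^ 2 + 4 * a₆) ∧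
      ¬ (3 : ℤ) ∣ c4 ∧ (3 : ℤ) ^ d ∣ Dsc ^ 2 ∧ d ≤ 2 * k ∧
      c4 ^ 3 * (c4 * (a ^ 3 - a) + 2 * ((a₁ ^ 2 + 4 * a₂) * (2 * a₄ + a₁ * a₃) - 18 * (a₃ ^ 2 + 4 * a₆)) *
        ((3 ^ k * e' : ℕ) : ℤ) ^ 2) + 120 * c6 * Dsc * ((3 ^ k * e' : ℕ) : ℤ) ^ 2 = N ∧
      ¬ (3 : ℤ) ^ (2 * k + d) ∣ N)
    {x y : ℚ} (hx : x = a / ((3 ^ k * e' : ℕ) : ℚ) ^ 2) (hy : y = b / ((3 ^ k * e' : ℕ) : ℚ) ^ 3)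
    (hP : W.toAffine.Equation x y) :
    ClassX11b W 3 → Ram W 3 → ¬ W.HasSplitMultiplicativeReductionAtPrime 3 → 3 ∣ W.tamagawaProduct →
      ClassClosure.RegulatorNonvanishingAt W 3 :=
  fun hX hram hns _ => rung_of_numCriterion_deep_j hGZK W hW H hx hy hP hX hram hns

end RankOne

end Summit.BirchSwinnertonDyer.Rank1Residual.X11b.RegMult.HeightLogNumerator

end
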